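import Mathlib

/-!
# Primes `q ≡ 3 (mod 4)` divide no odd-indexed Fibonacci number (solo-blind, s27; hodge.md §8.18.17)

Context.  The "p = 5 family" of the weight-two cyclotomic defect (hodge.md §8.18.16): at level `N = 5q`,
`q ≡ 3 (mod 4)` prime, the `(q−1)/2` plus Manin symbols of `Γ₀(5q)` lying over the cusp `∞` of `X₀(5)`
satisfy `CORANK(q)` independent linear relations, and exact computation (three independent methods,
every prime `q ≤ 1200`) together with a complete proof sketch give the GOLDEN-TORUS LAW
`CORANK(q) = (m(q) − 1)/2`, `m(q) := (q − (q|5)) / α(q)`, where `α(q)` is the rank of apparition of `q`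
in the Fibonacci sequence, i.e. the order of `A = (1 1; 1 0)` in `PGL₂(𝔽_q)`: the non-fibre symbols are
eliminated by the two triangles of `X₀(5)`, and the three residual gluing maps `σ`, `τ⁻¹στ`, `ετ = A⁻¹`
all normalise the torus `ℚ[A] ≅ ℚ(φ)`, so the relation count is an orbit count for the dihedral group
`⟨σ, A⟩` on `P¹(𝔽_q)`, coloured by parity.

Integrality of `(m − 1)/2` rests on two parity facts: `α(q)` is even and `m(q)` is odd when
`q ≡ 3 (mod 4)`.  This file proves the first in its classical form — a prime `q ≡ 3 (mod 4)` divides no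
`F_{2n+1}` — from `F_{2n+1} = F_{n+1}² + F_n²` (Mathlib `Nat.fib_two_mul_add_one`), the coprimality of
consecutive Fibonacci numbers, and `−1` not being a square mod `q`
(`ZMod.mod_four_ne_three_of_sq_eq_neg_sq'`).  Hence every index `n` with `q ∣ F_n` — in particular the
rank of apparition — is even.
-/

namespace Summit.KontsevichZagierPeriods.KontsevichZagierPeriods.Theorems

/-- A prime `q ≡ 3 (mod 4)` divides no odd-indexed Fibonacci number. -/
theorem soloBlind_prime_three_mod_four_not_dvd_fib_odd {q : ℕ} (hq : q.Prime) (h3 : q % 4 = 3)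
    (n : ℕ) : ¬ q ∣ Nat.fib (2 * n + 1) := by
  haveI : Fact q.Prime := ⟨hq⟩
  intro hdvd
  -- cast `F_{2n+1} = F_{n+1}^2 + F_n^2` into `ZMod q`
  have hsum : ((Nat.fib (n + 1) : ZMod q)) ^ 2 + ((Nat.fib n : ZMod q)) ^ 2 = 0 := by
    have h := (ZMod.natCast_eq_zero_iff (Nat.fib (2 * n + 1)) q).mpr hdvd
    rw [Nat.fib_two_mul_add_one] at h
    push_cast at h
    exact h
  have hsq : ((Nat.fib (n + 1) : ZMod q)) ^ 2 = -((Nat.fib n : ZMod q)) ^ 2 :=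
    eq_neg_of_add_eq_zero_left hsum
  by_cases hn : ((Nat.fib n : ZMod q)) = 0
  · -- then `F_{n+1} ≡ 0` too, contradicting `gcd(F_n, F_{n+1}) = 1`
    have hn1 : ((Nat.fib (n + 1) : ZMod q)) = 0 := by
      have : ((Nat.fib (n + 1) : ZMod q)) ^ 2 = 0 := by rw [hsq, hn]; ring
      exact pow_eq_zero_iff (n := 2) (by norm_num) |>.mp this
    have d0 : q ∣ Nat.fib n := (ZMod.natCast_eq_zero_iff _ _).mp hn
    have d1 : q ∣ Nat.fib (n + 1) := (ZMod.natCast_eq_zero_iff _ _).mp hn1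
    have hg : q ∣ Nat.gcd (Nat.fib n) (Nat.fib (n + 1)) := Nat.dvd_gcd d0 d1
    rw [(Nat.fib_coprime_fib_succ n).gcd_eq_one] at hg
    exact hq.one_lt.ne' (Nat.dvd_one.mp hg)
  · exact ZMod.mod_four_ne_three_of_sq_eq_neg_sq' hn hsq h3

/-- Hence every `n` with `q ∣ F_n` is even; in particular the rank of apparition `α(q)` of a prime
`q ≡ 3 (mod 4)` in the Fibonacci sequence is even. -/
theorem soloBlind_even_of_prime_three_mod_four_dvd_fib {q n : ℕ} (hq : q.Prime) (h3 : q % 4 = 3)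
    (h : q ∣ Nat.fib n) : Even n := by
  rcases Nat.even_or_odd n with he | ⟨k, rfl⟩
  · exact he
  · exact absurd h (soloBlind_prime_three_mod_four_not_dvd_fib_odd hq h3 k)

end Summit.KontsevichZagierPeriods.KontsevichZagierPeriods.Theorems
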